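import Summits.ResolutionOfSingularities.ResolutionOfSingularities.Theorems.FrobeniusLadderFRationalResolutionFixedPointGenerators
import HarnessLib

/-!
# Crux `FrobeniusLadder.FRationalResolution` (stmt-ResolutionOfSingularities-15317), line `redirect`,
# stub `stub_diagonalizableQuotientResolution` — STABILIZER-ADAPTED regular parameters at an ARBITRARY
# point of a regular graded ring (brick W1' of memo MEMO-15317-leafhand2-g4 §2bis: the wild,
# non-fixed points)

`S` graded by an abelian group `A` (`GradedAlgebra 𝒮`), `𝔔` a prime and `B ≤ A` a subgroup with
`S_a ⊆ 𝔔` for every `a ∉ B` (at any prime, the subgroup of "unit degrees"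
`{a : S_a ⊄ 𝔔}` of `…StabilizerSubgroup` qualifies; `B = ⊥` is the fixed case of
`…FixedPointGenerators`). Call an element of `𝔔` ADAPTED if it is either `A`-homogeneous of a degree
`∉ B`, or lies in the intermediate ring `T = S^{(B)} = ⊕_{b ∈ B} S_b` (all components of degree `∉ B`
vanish). Then `𝔔` is spanned by its adapted elements (split the homogeneous decomposition of
`s ∈ 𝔔` into the degrees `∉ B`, each of which lies in `𝔔`, and the rest, which lies in `T ∩ 𝔔`),
so a minimal system of generators of `𝔔 S_𝔔` — a regular system of parameters when `S` is regular —
can be chosen adapted. This is the entry point of the wild route W1'–W5': the adapted parameters of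
degree `∉ B` carry the `D(B)`-homogeneous log structure of `T`, the others are transverse.

* `decompose_sum_filter_mem_eq_zero` — components of degree `∉ B` of the `B`-part vanish;
* `span_adapted_eq` — `𝔔 = span {adapted elements of 𝔔}`;
* `exists_adapted_minimal_generators`, **`exists_adapted_regularParameters`** — adapted minimal
  generators of `𝔔 S_𝔔`, `card = emb dim`, resp. `= dim S_𝔔` for `S` regular.

Honest label: first brick of the wild non-fixed route (no stub closed). No definitions, no named
facts, no sorry. [folklore; cite: SGA3, Exp. VIII §4–5; BrunsHerzog1998, Prop. 1.5.15]
-/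

noncomputable section

-- single-problem summit: the doubled namespace component is forced
set_option linter.dupNamespace false

open DirectSum IsLocalRing

namespace Summit.ResolutionOfSingularities.ResolutionOfSingularities.Theorems.FRationalResolution.StabilizerAdaptedGenerators

universe u w

variable {k : Type u} [Field k] {A : Type w} [DecidableEq A] [AddCommGroup A] {S : Type u}
  [CommRing S] [Algebra k S] (𝒮 : A → Submodule k S) [GradedAlgebra 𝒮]

/-- The components of degree `∉ B` of a sum of homogeneous components of degrees `∈ B` vanish.
[folklore] -/
theorem decompose_sum_filter_mem_eq_zero (B : AddSubgroup A) [DecidablePred (· ∈ B)] (s : S)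
    (F : Finset A) {a : A} (ha : a ∉ B) :
    (decompose 𝒮 (∑ b ∈ F.filter (fun b => b ∈ B), (decompose 𝒮 s b : S)) a : S) = 0 := by
  classical
  refine Finset.sum_induction _ (fun x => (decompose 𝒮 x a : S) = 0) (fun x y hx hy => ?_) ?_ ?_
  · rw [decompose_add, DirectSum.add_apply, Submodule.coe_add, hx, hy, add_zero]
  · rw [decompose_zero, DirectSum.zero_apply, Submodule.coe_zero]
  · intro b hb
    have hbB : b ∈ B := (Finset.mem_filter.mp hb).2
    have hne : b ≠ a := fun h => ha (h ▸ hbB)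
    exact decompose_of_mem_ne 𝒮 (decompose 𝒮 s b).2 hne

/-- **A prime containing the pieces of degree `∉ B` is spanned by its adapted elements** (homogeneous
of degree `∉ B`, or with vanishing components outside `B`). [folklore; cite: SGA3, Exp. VIII §4–5] -/
theorem span_adapted_eq (𝔔 : Ideal S) (B : AddSubgroup A)
    (hB : ∀ a : A, a ∉ B → ∀ s ∈ 𝒮 a, s ∈ 𝔔) :
    Ideal.span {x : S | x ∈ 𝔔 ∧ ((∃ a : A, a ∉ B ∧ x ∈ 𝒮 a) ∨
      ∀ a : A, a ∉ B → (decompose 𝒮 x a : S) = 0)} = 𝔔 := by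
  classical
  apply le_antisymm
  · exact Ideal.span_le.mpr fun x hx => hx.1
  · intro s hs
    set F := (decompose 𝒮 s).support with hF
    have hsplit : s = (∑ a ∈ F.filter (fun a => a ∉ B), (decompose 𝒮 s a : S)) +
        ∑ b ∈ F.filter (fun b => b ∈ B), (decompose 𝒮 s b : S) := by
      conv_lhs => rw [← sum_support_decompose 𝒮 s]
      rw [← Finset.sum_filter_add_sum_filter_not F (fun a => a ∉ B)]
      congr 2
      ext b
      simp [F]
    -- the part of degrees `∉ B` lies in `𝔔`, termwise
    have hout : ∀ a ∈ F.filter (fun a => a ∉ B), (decompose 𝒮 s a : S) ∈ 𝔔 := fun a ha =>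
      hB a (Finset.mem_filter.mp ha).2 _ (decompose 𝒮 s a).2
    have hsum𝔔 : (∑ a ∈ F.filter (fun a => a ∉ B), (decompose 𝒮 s a : S)) ∈ 𝔔 :=
      Ideal.sum_mem _ hout
    have hrest𝔔 : (∑ b ∈ F.filter (fun b => b ∈ B), (decompose 𝒮 s b : S)) ∈ 𝔔 := by
      have heq : (∑ b ∈ F.filter (fun b => b ∈ B), (decompose 𝒮 s b : S)) =
          s - ∑ a ∈ F.filter (fun a => a ∉ B), (decompose 𝒮 s a : S) :=
        eq_sub_of_add_eq (by rw [add_comm]; exact hsplit.symm)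
      rw [heq]
      exact Ideal.sub_mem _ hs hsum𝔔
    rw [hsplit]
    refine Ideal.add_mem _ (Ideal.sum_mem _ fun a ha => Ideal.subset_span ⟨hout a ha, Or.inl
      ⟨a, (Finset.mem_filter.mp ha).2, (decompose 𝒮 s a).2⟩⟩) (Ideal.subset_span ⟨hrest𝔔, Or.inr ?_⟩)
    intro a ha
    exact decompose_sum_filter_mem_eq_zero 𝒮 B s F ha

/-- **Adapted minimal generators of the maximal ideal at any point.** `S` Noetherian graded, `𝔔` a
prime, `B ≤ A` with `S_a ⊆ 𝔔` for `a ∉ B`: there is a finite set `t` of ADAPTED elements of `𝔔`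
(homogeneous of degree `∉ B`, or with all components of degree `∉ B` zero) whose images generate
the maximal ideal of `S_𝔔`, of cardinality the embedding dimension `spanFinrank (𝔔 S_𝔔)`.
[folklore; cite: BrunsHerzog1998, Prop. 1.5.15] -/
theorem exists_adapted_minimal_generators [IsNoetherianRing S] (𝔔 : Ideal S) [𝔔.IsPrime]
    (B : AddSubgroup A) (hB : ∀ a : A, a ∉ B → ∀ s ∈ 𝒮 a, s ∈ 𝔔) :
    ∃ t : Finset S, (∀ x ∈ t, x ∈ 𝔔 ∧ ((∃ a : A, a ∉ B ∧ x ∈ 𝒮 a) ∨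
        ∀ a : A, a ∉ B → (decompose 𝒮 x a : S) = 0)) ∧
      Ideal.span (algebraMap S (Localization.AtPrime 𝔔) '' (↑t : Set S)) =
        maximalIdeal (Localization.AtPrime 𝔔) ∧
      t.card = (maximalIdeal (Localization.AtPrime 𝔔)).spanFinrank := by
  -- adapted from `…FixedPointGenerators.exists_homogeneous_minimal_generators_of_fixed`
  classical
  set H : Set S := {x : S | x ∈ 𝔔 ∧ ((∃ a : A, a ∉ B ∧ x ∈ 𝒮 a) ∨
    ∀ a : A, a ∉ B → (decompose 𝒮 x a : S) = 0)} with hH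
  set f := algebraMap S (Localization.AtPrime 𝔔) with hf
  have hG : Ideal.span (f '' H) = maximalIdeal (Localization.AtPrime 𝔔) := by
    rw [← Ideal.map_span, span_adapted_eq 𝒮 𝔔 B hB, Localization.AtPrime.map_eq_maximalIdeal]
  haveI : IsNoetherianRing (Localization.AtPrime 𝔔) :=
    IsLocalization.isNoetherianRing 𝔔.primeCompl _ inferInstance
  obtain ⟨t', ht'G, ht'span, ht'card⟩ :=
    FixedPointGenerators.exists_finset_subset_span_eq_card_eq_spanFinrank (f '' H) hG
  -- pull the generators back to adapted elements of `𝔔`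
  have hpre : ∀ y : t', ∃ x : S, x ∈ H ∧ f x = y := fun y => by
    obtain ⟨x, hx, hxy⟩ := ht'G y.2
    exact ⟨x, hx, hxy⟩
  choose g hgH hgf using hpre
  have hg_inj : Function.Injective g := fun y₁ y₂ h => by
    apply Subtype.ext
    rw [← hgf y₁, ← hgf y₂, h]
  let t : Finset S := Finset.univ.image g
  have ht_img : f '' (↑t : Set S) = (↑t' : Set _) := by
    rw [Finset.coe_image, Finset.coe_univ, Set.image_univ, ← Set.range_comp]
    ext y
    constructor
    · rintro ⟨y', rfl⟩
      rw [Function.comp_apply, hgf]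
      exact y'.2
    · intro hy
      exact ⟨⟨y, hy⟩, by rw [Function.comp_apply, hgf]⟩
  refine ⟨t, fun x hx => ?_, by rw [ht_img, ht'span], ?_⟩
  · rw [Finset.mem_image] at hx
    obtain ⟨y, -, rfl⟩ := hx
    exact hgH y
  · rw [Finset.card_image_of_injective _ hg_inj, Finset.card_univ, Fintype.card_coe, ht'card]

/-- **An adapted regular system of parameters at any point of a regular graded ring.** For `S`
regular (`IsRegularRing`), a prime `𝔔` and `B ≤ A` with `S_a ⊆ 𝔔` for `a ∉ B`, there are
`n = dim S_𝔔` adapted elements of `𝔔` (homogeneous of degree `∉ B`, or in `⊕_{b∈B} S_b`) whose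
images generate the maximal ideal of `S_𝔔`. [folklore; cite: SGA3, Exp. VIII §4–5] -/
theorem exists_adapted_regularParameters [IsRegularRing S] (𝔔 : Ideal S) [𝔔.IsPrime]
    (B : AddSubgroup A) (hB : ∀ a : A, a ∉ B → ∀ s ∈ 𝒮 a, s ∈ 𝔔) :
    ∃ t : Finset S, (∀ x ∈ t, x ∈ 𝔔 ∧ ((∃ a : A, a ∉ B ∧ x ∈ 𝒮 a) ∨
        ∀ a : A, a ∉ B → (decompose 𝒮 x a : S) = 0)) ∧
      Ideal.span (algebraMap S (Localization.AtPrime 𝔔) '' (↑t : Set S)) =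
        maximalIdeal (Localization.AtPrime 𝔔) ∧
      (t.card : WithBot ℕ∞) = ringKrullDim (Localization.AtPrime 𝔔) := by
  obtain ⟨t, hth, htspan, htcard⟩ := exists_adapted_minimal_generators 𝒮 𝔔 B hB
  haveI : IsRegularLocalRing (Localization.AtPrime 𝔔) :=
    IsRegularRing.isRegularLocalRing_localization 𝔔
  refine ⟨t, hth, htspan, ?_⟩
  rw [htcard]
  exact IsRegularLocalRing.spanFinrank_maximalIdeal

end Summit.ResolutionOfSingularities.ResolutionOfSingularities.Theorems.FRationalResolution.StabilizerAdaptedGenerators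

end
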